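import Literature.Analysis.FluidPDE.CaloricLocalLerayLp
import Literature.Analysis.FluidPDE.ClassicalSolutionCalculus
import HarnessLib

/-!
# Uniformly local enstrophy of the heat flow of `Lᵖ` data (local energy equality of `e^{tΔ}`)

Analysis/FluidPDE proof file (theorems only, no new definitions) in the discharge of the named
facts `Literature.Analysis.FluidPDE.bradshawTsai2017_caloric_localLeray` (`CaloricLocalLeray`)
and `Literature.Analysis.FluidPDE.bradshawTsai2017_section4` (`ForwardDSSLocalLeray`):
Bradshaw–Tsai, Ann. Henri Poincaré 18 (2017) [BT1], §4 (proof of Thm 1.2), the claim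
"`v₀ ∈ L²_uloc` implies `e^{tΔ}v₀` has uniformly locally finite energy **and enstrophy**". It
supplies the one hypothesis left open by `isCaloricLocalLerayField_heatExtension_of_memLp`
(`CaloricLocalLerayLp`): for `g ∈ Lᵖ(E; F')`, `2 ≤ p < ∞`, and every `R > 0`,

  `sup_{x₀} ∫₀^{R²} ∫_{B_R(x₀)} |∇ e^{tΔ}g|² dx dt < ∞`

(`exists_setLIntegral_box_frobeniusNormSq_fderiv_heatExtension_le`). Smoothing estimates alone
(`‖∇e^{tΔ}g‖_p ≲ t^{-1/2}‖g‖_p`) give only the non-integrable rate `t⁻¹` for the local enstrophy;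
the bound is the **local energy equality of the heat equation**, Lemarié-Rieusset, *The
Navier–Stokes problem in the 21st century* (2016), proof of Thm 14.1, Step 1 (the estimate
`‖W_{νt} ⋆ u₀‖_{E_ε} ≤ C_ν ‖u₀‖_{L²_uloc}`, whose `E_ε`-norm contains
`sup_x ‖∇ ⊗ u‖_{L²((0,T) × B(x,1))}`): for `u = e^{tΔ}g`, a cut-off `φ` (`= 1` on `B_R(x₀)`,
supported in `B_{2R}(x₀)`, `|∇φ| ≤ C/R`) and `0 < s < t`,

  `∫ φ²|u(t)|² + 2∫ₛᵗ∫ φ²|∇u|² = ∫ φ²|u(s)|² − 4∫ₛᵗ∫ φ (∂ᵢφ) ⟪∂ᵢu, u⟫`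
  `≤ ∫ φ²|u(s)|² + ∫ₛᵗ∫ φ²|∇u|² + 4∫ₛᵗ∫ |∇φ|²|u|²`,

so that `∫ₛᵗ∫_{B_R(x₀)} |∇u|² ≤ sup_τ ∫_{B_{3R}(x₀)} |u(τ)|² · (1 + 4n C² t/R²)`, uniformly in
`x₀` and `s`, by the uniformly local energy bound `∫_{B_r(x₀)} |e^{τΔ}g|² ≤ |B_r|^{1−2/p}‖g‖_p²`
(Hölder and the `Lᵖ` contraction); then `s → 0⁺` by monotone convergence.

## Contents (all proved)

* `integral_weight_mul_inner_laplacian_eq` — the viscous slice identity for a `C¹` compactly supported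
  weight `ψ` and a `C²` field `u`: `∫ ψ⟪u, Δu⟫ = −∫ ψ|∇u|² − ∫ Σᵢ ∂ᵢψ ⟪∂ᵢu, u⟫` (Green's first
  identity without boundary, `integral_inner_laplacian_add_eq_zero` of `WholeSpaceIBP`, exactly
  as in the viscous term of `IsClassicalNSSolutionOn.integral_cutoff_inner_timeDerivWithin`).
* `integral_sq_mul_inner_laplacian_le` — with `ψ = φ²`, Young's inequality absorbs the cross
  term: `∫ φ²·2⟪u, Δu⟫ ≤ −∫ φ²|∇u|² + 4 n M² ∫_S |u|²` (`|∇φ| ≤ M`, `∇φ = 0` off `S`).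
* `norm_sq_heatExtension_sub_eq_integral` — the heat equation on time lines:
  `|u(t,x)|² − |u(s,x)|² = ∫ₛᵗ 2⟪u, Δu⟫(τ,x) dτ` (`hasDerivAt_heatExtension_time`).
* `setLIntegral_ball_enorm_heatExtension_sq_le_of_memLp`, `integral_ball_norm_heatExtension_sq_le`
  — the uniformly local energy of `e^{tΔ}g` on a general space `E` (the `ℝ³` case is
  `setLIntegral_ball_enorm_heatExtension_sq_le` of `CaloricLocalLerayLp`).
* `integral_Ioo_integral_cutoff_sq_frobeniusNormSq_le` — the time-integrated local energy
  inequality on `(s, t)`, `0 < s` (Fubini on `(s,t) × E` via `integrable_prod_of_continuousOn`).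
* `setLIntegral_box_frobeniusNormSq_fderiv_heatExtension_le`,
  `exists_setLIntegral_box_frobeniusNormSq_fderiv_heatExtension_le` — the uniformly local
  enstrophy bound in the `lintegral` form consumed by `IsCaloricLocalLerayField`.

## Mathlib / tree search

Reused from the tree (nothing redefined): the cut-off `cutoff R` with
`exists_norm_fderiv_cutoff_le`, `cutoff_eq_one`, `cutoff_eq_zero` and the boundary-free Green
identity `integral_inner_laplacian_add_eq_zero` (`WholeSpaceIBP`); `frobeniusNormSq`
(`VectorCalculus`); `integrable_prod_of_continuousOn` (`ClassicalSolutionCalculus`); the `Lᵖ`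
calculus of the heat flow `contDiff_heatExtension_holds`, `hasDerivAt_heatExtension_time`,
`continuousOn_uncurry_heatExtension_of_memLp`, `continuousOn_uncurry_fderiv_heatExtension_of_memLp`,
`continuousOn_uncurry_laplacian_heatExtension_of_memLp`, `continuousOn_heatExtension_time`,
`continuousOn_laplacian_heatExtension_time`, `eLpNorm_heatExtension_le_holds`
(`UnboundedOperators/HeatKernel*`, `HeatFlowCalculus`); `setLIntegral_enorm_sq_le_measure_rpow_mul`,
`lintegral_rpow_enorm_rpow_two_div`, `sub_two_div_toReal_nonneg`,
`LerayHopfProofs.continuous_frobeniusNormSq` (`CaloricLocalLerayLp`, `LerayHopfProofs`).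
Mathlib: `HasDerivAt.norm_sq`, `intervalIntegral.integral_eq_sub_of_hasDerivAt`,
`integral_integral_swap`, `integral_prod`, `ofReal_integral_eq_lintegral_ofReal`,
`setLIntegral_iUnion_of_directed`, `fderiv_comp_sub`. `lean search 'enstrophy.*heat|heatExtension.*frobenius|local energy.*heat'`:
no prior local energy inequality for the heat flow in the tree (`LerayHopfProofs` has the
classical Navier–Stokes version, tied to `IsClassicalNSSolutionOn` and divergence-free fields).

## References

* Z. Bradshaw, T.-P. Tsai, *Forward discretely self-similar solutions of the Navier–Stokes
  equations II*, Ann. Henri Poincaré 18 (2017) 1095–1119 = arXiv:1510.07504, §1 (Def. 1.1),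
  §4 (proof of Thm 1.2: "`e^{tΔ}v₀` has uniformly locally finite energy and enstrophy")
  [BradshawTsai2017AHP].
* P. G. Lemarié-Rieusset, *The Navier–Stokes problem in the 21st century*, CRC Press 2016,
  Thm 14.1 (proof, Step 1, (14.5)) [LemarieRieusset2016].
* L. C. Evans, *Partial differential equations*, 2nd ed., §2.3.1 Thm 1, §7.1.2 (energy
  estimates) [Evans2010].
-/

noncomputable section

open MeasureTheory Set Function Filter Topology TopologicalSpace Metric InnerProductSpace
open scoped NNReal ENNReal RealInnerProductSpace Laplacian

namespace Literature.Analysis.FluidPDE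

open UnboundedOperators

/-! ### The viscous slice identity and the Young absorption -/

section Slice

variable {E : Type*} [NormedAddCommGroup E] [InnerProductSpace ℝ E] [FiniteDimensional ℝ E]
  [MeasurableSpace E] [BorelSpace E]
variable {F' : Type*} [NormedAddCommGroup F'] [InnerProductSpace ℝ F'] [FiniteDimensional ℝ F']

/-- **The viscous slice identity.** For a `C²` field `u : E → F'` and a `C¹` compactly supported
weight `ψ`, `∫ ψ ⟪u, Δu⟫ = −∫ ψ |∇u|² − ∫ Σᵢ ∂ᵢψ ⟪∂ᵢu, u⟫` (Green's first identity without
boundary applied to `v = u`, `w = ψ u`; only first derivatives of `ψ` appear). Leray 1934, §17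
(the computation giving (3.4)); Evans, *PDE*, §7.1.2. [folklore] -/
theorem integral_weight_mul_inner_laplacian_eq {u : E → F'} {ψ : E → ℝ} (hu : ContDiff ℝ 2 u)
    (hψ : ContDiff ℝ 1 ψ) (hc : HasCompactSupport ψ) :
    ∫ x, ψ x * ⟪u x, (Δ u) x⟫ =
      -(∫ x, ψ x * frobeniusNormSq (fderiv ℝ u x)) -
        ∫ x, ∑ i, fderiv ℝ ψ x (stdOrthonormalBasis ℝ E i) *
          ⟪fderiv ℝ u x (stdOrthonormalBasis ℝ E i), u x⟫ := by
  set b := stdOrthonormalBasis ℝ E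
  set w : E → F' := fun x => ψ x • u x with hw
  have hu1 : ContDiff ℝ 1 u := hu.of_le one_le_two
  have hw1 : ContDiff ℝ 1 w := hψ.smul hu1
  have hcw : HasCompactSupport w := hc.smul_right
  have huc : Continuous u := hu1.continuous
  have hψc : Continuous ψ := hψ.continuous
  have hDψc : Continuous (fderiv ℝ ψ) := hψ.continuous_fderiv one_ne_zero
  have hDuc : Continuous (fderiv ℝ u) := hu1.continuous_fderiv one_ne_zero
  -- Leibniz rule for `w = ψ u`
  have hDw : ∀ x v, fderiv ℝ w x v = ψ x • fderiv ℝ u x v + (fderiv ℝ ψ x v) • u x :=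
    fun x v => by
      simp [hw, fderiv_fun_smul (hψ.differentiable one_ne_zero x)
        (hu1.differentiable one_ne_zero x)]
  -- integrability of the terms (continuous with compact support)
  have cs_ψ : ∀ {g : E → ℝ}, Continuous g → Integrable (fun x => ψ x * g x) (volume : Measure E) :=
    fun hg => (hψc.mul hg).integrable_of_hasCompactSupport hc.mul_right
  have cs_Dψ : ∀ {g : E → ℝ} (v : E), Continuous g →
      Integrable (fun x => fderiv ℝ ψ x v * g x) (volume : Measure E) := fun v hg =>
    ((hDψc.clm_apply continuous_const).mul hg).integrable_of_hasCompactSupport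
      (hc.fderiv_apply (𝕜 := ℝ) v).mul_right
  have h0 := integral_inner_laplacian_add_eq_zero b hu hw1 (Or.inr hcw)
  have iA : ∀ i, Integrable (fun x => ψ x * ‖fderiv ℝ u x (b i)‖ ^ 2) (volume : Measure E) :=
    fun i => cs_ψ ((hDuc.clm_apply continuous_const).norm.pow 2)
  have iB : ∀ i, Integrable (fun x => fderiv ℝ ψ x (b i) * ⟪fderiv ℝ u x (b i), u x⟫)
      (volume : Measure E) := fun i =>
    cs_Dψ (b i) ((hDuc.clm_apply continuous_const).inner huc)
  have h1 : ∀ i, ∫ x, ⟪fderiv ℝ u x (b i), fderiv ℝ w x (b i)⟫ =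
      (∫ x, ψ x * ‖fderiv ℝ u x (b i)‖ ^ 2) +
        ∫ x, fderiv ℝ ψ x (b i) * ⟪fderiv ℝ u x (b i), u x⟫ := fun i => by
    rw [← integral_add (iA i) (iB i)]
    refine integral_congr_ae (Eventually.of_forall fun x => ?_)
    simp only [hDw, inner_add_right, real_inner_smul_right, real_inner_self_eq_norm_sq]
  have h2 : ∑ i, ∫ x, ψ x * ‖fderiv ℝ u x (b i)‖ ^ 2 =
      ∫ x, ψ x * frobeniusNormSq (fderiv ℝ u x) := by
    rw [← integral_finsetSum _ fun i _ => iA i]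
    refine integral_congr_ae (Eventually.of_forall fun x => ?_)
    simp only [frobeniusNormSq_eq_sum b, Finset.mul_sum]
  have h3 : ∑ i, ∫ x, fderiv ℝ ψ x (b i) * ⟪fderiv ℝ u x (b i), u x⟫ =
      ∫ x, ∑ i, fderiv ℝ ψ x (b i) * ⟪fderiv ℝ u x (b i), u x⟫ :=
    (integral_finsetSum _ fun i _ => iB i).symm
  simp_rw [h1] at h0
  rw [Finset.sum_add_distrib, h2, h3] at h0
  have hA : ∫ x, ⟪(Δ u) x, w x⟫ = ∫ x, ψ x * ⟪u x, (Δ u) x⟫ :=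
    integral_congr_ae (Eventually.of_forall fun x => by
      simp only [hw, real_inner_smul_right]
      rw [real_inner_comm])
  rw [hA] at h0
  linarith

omit [MeasurableSpace E] [BorelSpace E] in
/-- The sum of the squared partial derivatives of a scalar function is at most `n ‖Dφ(x)‖²`
(`n = dim E`; each `|∂ᵢφ| ≤ ‖Dφ‖`). [folklore] -/
theorem sum_sq_fderiv_apply_le (φ : E → ℝ) (x : E) :
    ∑ i, (fderiv ℝ φ x (stdOrthonormalBasis ℝ E i)) ^ 2 ≤
      (Module.finrank ℝ E : ℝ) * ‖fderiv ℝ φ x‖ ^ 2 := by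
  set b := stdOrthonormalBasis ℝ E
  have hle : ∀ i, (fderiv ℝ φ x (b i)) ^ 2 ≤ ‖fderiv ℝ φ x‖ ^ 2 := fun i => by
    rw [← sq_abs, ← Real.norm_eq_abs]
    refine pow_le_pow_left₀ (norm_nonneg _) ?_ 2
    simpa [b.orthonormal.1 i] using (fderiv ℝ φ x).le_opNorm (b i)
  calc ∑ i, (fderiv ℝ φ x (b i)) ^ 2 ≤ ∑ _i : Fin (Module.finrank ℝ E), ‖fderiv ℝ φ x‖ ^ 2 :=
        Finset.sum_le_sum fun i _ => hle i
    _ = (Module.finrank ℝ E : ℝ) * ‖fderiv ℝ φ x‖ ^ 2 := by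
        rw [Finset.sum_const, Finset.card_univ, Fintype.card_fin, nsmul_eq_mul]

omit [MeasurableSpace E] [BorelSpace E] [FiniteDimensional ℝ F'] in
/-- **Young's absorption, pointwise.** For `C¹` `φ` and `u`:
`−Σᵢ ∂ᵢ(φ²) ⟪∂ᵢu, u⟫ ≤ ½ φ² Σᵢ ‖∂ᵢu‖² + 2 (Σᵢ (∂ᵢφ)²) ‖u‖²`
(`∂ᵢ(φ²) = 2φ∂ᵢφ` and `2ab ≤ a²/2 + 2b²`). [folklore] -/
theorem neg_sum_fderiv_sq_mul_inner_le {u : E → F'} {φ : E → ℝ} (hφ : ContDiff ℝ 1 φ) (x : E) :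
    -(∑ i, fderiv ℝ (fun y => φ y * φ y) x (stdOrthonormalBasis ℝ E i) *
        ⟪fderiv ℝ u x (stdOrthonormalBasis ℝ E i), u x⟫) ≤
      2⁻¹ * (φ x * φ x * ∑ i, ‖fderiv ℝ u x (stdOrthonormalBasis ℝ E i)‖ ^ 2) +
        2 * (∑ i, (fderiv ℝ φ x (stdOrthonormalBasis ℝ E i)) ^ 2) * ‖u x‖ ^ 2 := by
  set b := stdOrthonormalBasis ℝ E
  have hd : DifferentiableAt ℝ φ x := hφ.differentiable one_ne_zero x
  have hDsq : ∀ v, fderiv ℝ (fun y => φ y * φ y) x v = 2 * φ x * fderiv ℝ φ x v := fun v => by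
    rw [fderiv_fun_mul hd hd]
    simp only [_root_.add_apply, _root_.FunLike.coe_smul, Pi.smul_apply, smul_eq_mul]
    ring
  have hRHS : 2⁻¹ * (φ x * φ x * ∑ i, ‖fderiv ℝ u x (b i)‖ ^ 2) +
      2 * (∑ i, (fderiv ℝ φ x (b i)) ^ 2) * ‖u x‖ ^ 2 =
      ∑ i, (2⁻¹ * (φ x * φ x * ‖fderiv ℝ u x (b i)‖ ^ 2) +
        2 * (fderiv ℝ φ x (b i)) ^ 2 * ‖u x‖ ^ 2) := by
    rw [Finset.sum_add_distrib, Finset.mul_sum, Finset.mul_sum, Finset.mul_sum, Finset.sum_mul]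
  rw [hRHS, ← Finset.sum_neg_distrib]
  refine Finset.sum_le_sum fun i _ => ?_
  rw [hDsq]
  have hcs : |⟪fderiv ℝ u x (b i), u x⟫| ≤ ‖fderiv ℝ u x (b i)‖ * ‖u x‖ :=
    abs_real_inner_le_norm _ _
  have hY : 2 * (|φ x| * ‖fderiv ℝ u x (b i)‖) * (|fderiv ℝ φ x (b i)| * ‖u x‖) ≤
      2⁻¹ * (|φ x| * ‖fderiv ℝ u x (b i)‖) ^ 2 + 2 * (|fderiv ℝ φ x (b i)| * ‖u x‖) ^ 2 := by
    nlinarith [sq_nonneg (|φ x| * ‖fderiv ℝ u x (b i)‖ - 2 * (|fderiv ℝ φ x (b i)| * ‖u x‖))]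
  have habs : -(2 * φ x * fderiv ℝ φ x (b i) * ⟪fderiv ℝ u x (b i), u x⟫) ≤
      2 * (|φ x| * ‖fderiv ℝ u x (b i)‖) * (|fderiv ℝ φ x (b i)| * ‖u x‖) := by
    calc -(2 * φ x * fderiv ℝ φ x (b i) * ⟪fderiv ℝ u x (b i), u x⟫)
        ≤ |2 * φ x * fderiv ℝ φ x (b i) * ⟪fderiv ℝ u x (b i), u x⟫| := neg_le_abs _
      _ = 2 * |φ x| * |fderiv ℝ φ x (b i)| * |⟪fderiv ℝ u x (b i), u x⟫| := by
          rw [abs_mul, abs_mul, abs_mul, abs_two]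
      _ ≤ 2 * |φ x| * |fderiv ℝ φ x (b i)| * (‖fderiv ℝ u x (b i)‖ * ‖u x‖) := by
          gcongr
      _ = _ := by ring
  refine (habs.trans hY).trans (le_of_eq ?_)
  rw [mul_pow, mul_pow, sq_abs, sq_abs]
  ring

/-- **The localised viscous inequality with Young absorption.** For a `C²` field `u`, a `C¹`
compactly supported cut-off `φ` with `‖Dφ‖ ≤ M` everywhere and `Dφ = 0` off a measurable set `S`
on which `|u|²` is integrable with `∫_S |u|² ≤ Eb`:
`∫ φ² · 2⟪u, Δu⟫ ≤ −∫ φ² |∇u|² + 4 n M² Eb` (`n = dim E`). This is the viscous part of the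
local energy inequality (Lemarié-Rieusset 2016, proof of Thm 14.1, Step 1; Evans, *PDE*,
§7.1.2 Thm 2, the energy estimate with a cut-off). [cite: LemarieRieusset2016, Theorem 14.1 (proof, Step 1)] -/
theorem integral_sq_mul_inner_laplacian_le {u : E → F'} {φ : E → ℝ} (hu : ContDiff ℝ 2 u)
    (hφ : ContDiff ℝ 1 φ) (hc : HasCompactSupport φ) {M : ℝ} (hM : ∀ x, ‖fderiv ℝ φ x‖ ≤ M)
    {S : Set E} (hS : MeasurableSet S) (hφS : ∀ x ∉ S, fderiv ℝ φ x = 0) {Eb : ℝ}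
    (hint : IntegrableOn (fun x => ‖u x‖ ^ 2) S volume) (hE : ∫ x in S, ‖u x‖ ^ 2 ≤ Eb) :
    ∫ x, φ x * φ x * (2 * ⟪u x, (Δ u) x⟫) ≤
      -(∫ x, φ x * φ x * frobeniusNormSq (fderiv ℝ u x)) +
        4 * (Module.finrank ℝ E : ℝ) * M ^ 2 * Eb := by
  set b := stdOrthonormalBasis ℝ E
  set n : ℝ := (Module.finrank ℝ E : ℝ)
  have hψ : ContDiff ℝ 1 fun y => φ y * φ y := hφ.mul hφ
  have hψc : HasCompactSupport fun y => φ y * φ y := hc.mul_right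
  have hu1 : ContDiff ℝ 1 u := hu.of_le one_le_two
  have huc : Continuous u := hu1.continuous
  have hDuc : Continuous (fderiv ℝ u) := hu1.continuous_fderiv one_ne_zero
  have hφc' : Continuous φ := hφ.continuous
  have hDφc : Continuous (fderiv ℝ φ) := hφ.continuous_fderiv one_ne_zero
  have hM0 : 0 ≤ M := (norm_nonneg _).trans (hM 0)
  -- the slice identity with `ψ = φ²`
  have key := integral_weight_mul_inner_laplacian_eq hu hψ hψc
  -- integrability
  have iF : Integrable (fun x => φ x * φ x * frobeniusNormSq (fderiv ℝ u x)) (volume : Measure E) :=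
    ((hφc'.mul hφc').mul (LerayHopfProofs.continuous_frobeniusNormSq.comp hDuc)).integrable_of_hasCompactSupport
      hψc.mul_right
  have iX : Integrable (fun x => ∑ i, fderiv ℝ (fun y => φ y * φ y) x (b i) *
      ⟪fderiv ℝ u x (b i), u x⟫) (volume : Measure E) := by
    refine integrable_finsetSum _ fun i _ => ?_
    exact (((hψ.continuous_fderiv one_ne_zero).clm_apply continuous_const).mul
      ((hDuc.clm_apply continuous_const).inner huc)).integrable_of_hasCompactSupport
      (hψc.fderiv_apply (𝕜 := ℝ) (b i)).mul_right
  have iI : Integrable (fun x => S.indicator (fun y => ‖u y‖ ^ 2) x) (volume : Measure E) :=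
    hint.integrable_indicator hS
  -- pointwise Young absorption and the bound on `Σᵢ (∂ᵢφ)²`
  have hpt : ∀ x, -(∑ i, fderiv ℝ (fun y => φ y * φ y) x (b i) * ⟪fderiv ℝ u x (b i), u x⟫) ≤
      2⁻¹ * (φ x * φ x * frobeniusNormSq (fderiv ℝ u x)) +
        2 * n * M ^ 2 * S.indicator (fun y => ‖u y‖ ^ 2) x := by
    intro x
    refine (neg_sum_fderiv_sq_mul_inner_le hφ x).trans ?_
    rw [← frobeniusNormSq_eq_sum b]
    refine add_le_add le_rfl ?_
    by_cases hx : x ∈ S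
    · rw [indicator_of_mem hx]
      have h1 := sum_sq_fderiv_apply_le φ x
      have h2 : ‖fderiv ℝ φ x‖ ^ 2 ≤ M ^ 2 := pow_le_pow_left₀ (norm_nonneg _) (hM x) 2
      have h3 : ∑ i, (fderiv ℝ φ x (b i)) ^ 2 ≤ n * M ^ 2 :=
        h1.trans (mul_le_mul_of_nonneg_left h2 (Nat.cast_nonneg _))
      calc 2 * (∑ i, (fderiv ℝ φ x (b i)) ^ 2) * ‖u x‖ ^ 2 ≤ 2 * (n * M ^ 2) * ‖u x‖ ^ 2 := by
            gcongr
        _ = 2 * n * M ^ 2 * ‖u x‖ ^ 2 := by ring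
    · rw [indicator_of_notMem hx, hφS x hx]
      simp
  have hmono : ∫ x, -(∑ i, fderiv ℝ (fun y => φ y * φ y) x (b i) * ⟪fderiv ℝ u x (b i), u x⟫) ≤
      ∫ x, (2⁻¹ * (φ x * φ x * frobeniusNormSq (fderiv ℝ u x)) +
        2 * n * M ^ 2 * S.indicator (fun y => ‖u y‖ ^ 2) x) :=
    integral_mono iX.neg ((iF.const_mul _).add (iI.const_mul _)) hpt
  rw [integral_neg, integral_add (iF.const_mul _) (iI.const_mul _), integral_const_mul,
    integral_const_mul, integral_indicator hS] at hmono
  -- assemble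
  have h2 : ∫ x, φ x * φ x * (2 * ⟪u x, (Δ u) x⟫) = 2 * ∫ x, φ x * φ x * ⟪u x, (Δ u) x⟫ := by
    rw [← integral_const_mul]
    exact integral_congr_ae (Eventually.of_forall fun x => by ring)
  rw [h2, key]
  have hEb : 2 * n * M ^ 2 * ∫ x in S, ‖u x‖ ^ 2 ≤ 2 * n * M ^ 2 * Eb :=
    mul_le_mul_of_nonneg_left hE (by positivity)
  have hBnn : 0 ≤ ∫ x, φ x * φ x * frobeniusNormSq (fderiv ℝ u x) :=
    integral_nonneg fun x => mul_nonneg (mul_self_nonneg _) (frobeniusNormSq_nonneg _)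
  nlinarith [hmono, hEb, hBnn]

end Slice

/-! ### The heat flow: time lines, uniformly local energy, the local energy inequality -/

section HeatFlow

variable {E : Type*} [NormedAddCommGroup E] [InnerProductSpace ℝ E] [FiniteDimensional ℝ E]
  [MeasurableSpace E] [BorelSpace E]
variable {F' : Type*} [NormedAddCommGroup F'] [InnerProductSpace ℝ F'] [FiniteDimensional ℝ F']
variable {g : E → F'} {p : ℝ≥0∞}

/-- **The heat equation on time lines.** For `g ∈ Lᵖ`, `1 ≤ p`, `0 < s ≤ t` and every `x`,
`|e^{tΔ}g(x)|² − |e^{sΔ}g(x)|² = ∫ₛᵗ 2⟪e^{τΔ}g(x), Δe^{τΔ}g(x)⟫ dτ` (the heat equation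
`hasDerivAt_heatExtension_time` and the fundamental theorem of calculus). Evans, *PDE*,
§2.3.1 Thm 1 (ii). [folklore] -/
theorem norm_sq_heatExtension_sub_eq_integral (hg : MemLp g p volume) (hp : 1 ≤ p) {s t : ℝ}
    (hs : 0 < s) (hst : s ≤ t) (x : E) :
    ‖heatExtension g t x‖ ^ 2 - ‖heatExtension g s x‖ ^ 2 =
      ∫ τ in s..t, 2 * ⟪heatExtension g τ x, (Δ (heatExtension g τ)) x⟫ := by
  haveI : CompleteSpace F' := FiniteDimensional.complete ℝ F'
  rw [intervalIntegral.integral_eq_sub_of_hasDerivAt]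
  · intro τ hτ
    rw [uIcc_of_le hst] at hτ
    exact (hasDerivAt_heatExtension_time (lt_of_lt_of_le hs hτ.1) hg hp x).norm_sq
  · refine ContinuousOn.intervalIntegrable ?_
    rw [uIcc_of_le hst]
    refine continuousOn_const.mul (ContinuousOn.inner ?_ ?_)
    · exact (continuousOn_heatExtension_time hg hp x).mono fun τ hτ => lt_of_lt_of_le hs hτ.1
    · exact (continuousOn_laplacian_heatExtension_time hg hp x).mono
        fun τ hτ => lt_of_lt_of_le hs hτ.1

/-- **Uniformly local energy of the caloric extension of `Lᵖ` data** on a general space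
(`2 ≤ p < ∞`, `t > 0`): `∫_{B_r(x₀)} |e^{tΔ}g|² ≤ |B_r|^{1−2/p} ‖g‖_p²` (Hölder on the ball and
the `Lᵖ` contraction; the `ℝ³` case is `setLIntegral_ball_enorm_heatExtension_sq_le`).
Lemarié-Rieusset 2016, proof of Thm 14.1, Step 1. [cite: LemarieRieusset2016, Theorem 14.1 (proof, Step 1)] -/
theorem setLIntegral_ball_enorm_heatExtension_sq_le_of_memLp (hp : 2 ≤ p) (hp' : p ≠ ∞)
    (hg : MemLp g p volume) {t : ℝ} (ht : 0 < t) (x₀ : E) (r : ℝ) :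
    ∫⁻ x in ball x₀ r, ‖heatExtension g t x‖ₑ ^ 2 ≤
      volume (ball (0 : E) r) ^ (1 - 2 / p.toReal) * eLpNorm g p volume ^ 2 := by
  haveI : CompleteSpace F' := FiniteDimensional.complete ℝ F'
  have hp1 : 1 ≤ p := one_le_two.trans hp
  have hp0 : p ≠ 0 := (zero_lt_one.trans_le hp1).ne'
  have hc : Continuous (heatExtension g t) := (contDiff_heatExtension_holds hg hp1 ht).continuous
  calc ∫⁻ x in ball x₀ r, ‖heatExtension g t x‖ₑ ^ 2
      ≤ volume (ball x₀ r) ^ (1 - 2 / p.toReal) *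
          (∫⁻ x in ball x₀ r, ‖heatExtension g t x‖ₑ ^ p.toReal) ^ (2 / p.toReal) :=
        setLIntegral_enorm_sq_le_measure_rpow_mul hp hp' hc.aestronglyMeasurable.restrict
    _ ≤ volume (ball (0 : E) r) ^ (1 - 2 / p.toReal) *
          (∫⁻ x, ‖heatExtension g t x‖ₑ ^ p.toReal) ^ (2 / p.toReal) := by
        rw [Measure.addHaar_ball_center]
        gcongr
        exact Measure.restrict_le_self
    _ = volume (ball (0 : E) r) ^ (1 - 2 / p.toReal) *
          eLpNorm (heatExtension g t) p volume ^ 2 := by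
        rw [lintegral_rpow_enorm_rpow_two_div _ hp0 hp']
    _ ≤ volume (ball (0 : E) r) ^ (1 - 2 / p.toReal) * eLpNorm g p volume ^ 2 := by
        gcongr
        exact eLpNorm_heatExtension_le_holds hg hp1 ht

omit [InnerProductSpace ℝ F'] [FiniteDimensional ℝ F'] in
/-- The uniformly local energy majorant `|B_r|^{1−2/p} ‖g‖_p²` is finite. [folklore] -/
theorem ball_rpow_mul_eLpNorm_sq_ne_top (hp : 2 ≤ p) (hp' : p ≠ ∞) (hg : MemLp g p volume)
    (r : ℝ) : volume (ball (0 : E) r) ^ (1 - 2 / p.toReal) * eLpNorm g p volume ^ 2 ≠ ∞ :=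
  ENNReal.mul_ne_top
    (ENNReal.rpow_ne_top_of_nonneg (sub_two_div_toReal_nonneg hp hp') measure_ball_lt_top.ne)
    (ENNReal.pow_ne_top hg.eLpNorm_ne_top)

/-- **Uniformly local energy, real form**: `∫_{B_r(x₀)} |e^{tΔ}g|² dx ≤ (|B_r|^{1−2/p} ‖g‖_p²)`
as a Bochner integral (`2 ≤ p < ∞`, `t > 0`). [cite: LemarieRieusset2016, Theorem 14.1 (proof, Step 1)] -/
theorem integral_ball_norm_heatExtension_sq_le (hp : 2 ≤ p) (hp' : p ≠ ∞) (hg : MemLp g p volume)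
    {t : ℝ} (ht : 0 < t) (x₀ : E) (r : ℝ) :
    ∫ x in ball x₀ r, ‖heatExtension g t x‖ ^ 2 ≤
      (volume (ball (0 : E) r) ^ (1 - 2 / p.toReal) * eLpNorm g p volume ^ 2).toReal := by
  haveI : CompleteSpace F' := FiniteDimensional.complete ℝ F'
  have hp1 : 1 ≤ p := one_le_two.trans hp
  have hc : Continuous (heatExtension g t) := (contDiff_heatExtension_holds hg hp1 ht).continuous
  have hm : AEStronglyMeasurable (fun x => ‖heatExtension g t x‖ ^ 2)
      ((volume : Measure E).restrict (ball x₀ r)) :=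
    (hc.norm.pow 2).aestronglyMeasurable.restrict
  rw [integral_eq_lintegral_of_nonneg_ae (Eventually.of_forall fun x => sq_nonneg _) hm]
  refine ENNReal.toReal_mono (ball_rpow_mul_eLpNorm_sq_ne_top hp hp' hg r) ?_
  calc ∫⁻ x in ball x₀ r, ENNReal.ofReal (‖heatExtension g t x‖ ^ 2)
      = ∫⁻ x in ball x₀ r, ‖heatExtension g t x‖ₑ ^ 2 :=
        lintegral_congr fun x => by rw [← ofReal_norm, ENNReal.ofReal_pow (norm_nonneg _)]
    _ ≤ _ := setLIntegral_ball_enorm_heatExtension_sq_le_of_memLp hp hp' hg ht x₀ r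

/-- Slices of the caloric extension have locally integrable energy: `|e^{tΔ}g|²` is integrable
on every ball (`t > 0`). [folklore] -/
theorem integrableOn_ball_norm_heatExtension_sq (hg : MemLp g p volume) (hp : 1 ≤ p) {t : ℝ}
    (ht : 0 < t) (x₀ : E) (r : ℝ) :
    IntegrableOn (fun x => ‖heatExtension g t x‖ ^ 2) (ball x₀ r) volume := by
  haveI : CompleteSpace F' := FiniteDimensional.complete ℝ F'
  have hc : Continuous (heatExtension g t) := (contDiff_heatExtension_holds hg hp ht).continuous
  exact ((hc.norm.pow 2).continuousOn.integrableOn_compact (isCompact_closedBall x₀ r)).mono_set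
    ball_subset_closedBall

/-! #### The translated cut-off -/

omit [FiniteDimensional ℝ E] [MeasurableSpace E] [BorelSpace E] in
/-- The translated cut-off `x ↦ χ_R(x − x₀)` is smooth. [folklore] -/
theorem contDiff_cutoff_sub (R : ℝ) (x₀ : E) {n : ℕ∞} :
    ContDiff ℝ n fun x => cutoff R (x - x₀) :=
  (contDiff_cutoff R).comp (contDiff_id.sub contDiff_const)

omit [FiniteDimensional ℝ E] [MeasurableSpace E] [BorelSpace E] in
/-- The translated cut-off vanishes off `B_{2R}(x₀)`. [folklore] -/
theorem cutoff_sub_eq_zero_of_notMem_ball {R : ℝ} (hR : 0 < R) {x₀ x : E}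
    (hx : x ∉ ball x₀ (2 * R)) : cutoff R (x - x₀) = 0 := by
  refine cutoff_eq_zero hR ?_
  rwa [mem_ball_iff_norm, not_lt] at hx

omit [FiniteDimensional ℝ E] [MeasurableSpace E] [BorelSpace E] in
/-- The translated cut-off equals `1` on `B_R(x₀)`. [folklore] -/
theorem cutoff_sub_eq_one_of_mem_ball {R : ℝ} (hR : 0 < R) {x₀ x : E} (hx : x ∈ ball x₀ R) :
    cutoff R (x - x₀) = 1 :=
  cutoff_eq_one hR (le_of_lt (by rwa [mem_ball_iff_norm] at hx))

omit [FiniteDimensional ℝ E] [MeasurableSpace E] [BorelSpace E] in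
/-- The translated cut-off has support in `B̄_{2R}(x₀)`, hence compact support. [folklore] -/
theorem tsupport_cutoff_sub_subset {R : ℝ} (hR : 0 < R) (x₀ : E) :
    tsupport (fun x => cutoff R (x - x₀)) ⊆ closedBall x₀ (2 * R) := by
  refine closure_minimal (fun x hx => ?_) isClosed_closedBall
  by_contra h
  exact hx (cutoff_sub_eq_zero_of_notMem_ball hR fun h' => h (ball_subset_closedBall h'))

omit [MeasurableSpace E] [BorelSpace E] in
/-- The translated cut-off has compact support. [folklore] -/
theorem hasCompactSupport_cutoff_sub {R : ℝ} (hR : 0 < R) (x₀ : E) :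
    HasCompactSupport fun x => cutoff R (x - x₀) :=
  (isCompact_closedBall x₀ (2 * R)).of_isClosed_subset (isClosed_tsupport _)
    (tsupport_cutoff_sub_subset hR x₀)

omit [FiniteDimensional ℝ E] [MeasurableSpace E] [BorelSpace E] in
/-- The gradient of the translated cut-off vanishes off `B_{3R}(x₀)`. [folklore] -/
theorem fderiv_cutoff_sub_eq_zero {R : ℝ} (hR : 0 < R) {x₀ x : E} (hx : x ∉ ball x₀ (3 * R)) :
    fderiv ℝ (fun y => cutoff R (y - x₀)) x = 0 := by
  refine fderiv_of_notMem_tsupport ℝ fun h => hx ?_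
  have h2 := tsupport_cutoff_sub_subset hR x₀ h
  rw [mem_closedBall] at h2
  rw [mem_ball]
  linarith

omit [FiniteDimensional ℝ E] [MeasurableSpace E] [BorelSpace E] in
/-- The gradient bound of the cut-off is translation invariant:
`‖D(χ_R(· − x₀))(x)‖ = ‖Dχ_R(x − x₀)‖`. [folklore] -/
theorem norm_fderiv_cutoff_sub (R : ℝ) (x₀ x : E) :
    ‖fderiv ℝ (fun y => cutoff R (y - x₀)) x‖ = ‖fderiv ℝ (cutoff R) (x - x₀)‖ := by
  rw [fderiv_comp_sub]

/-! #### The local energy inequality integrated over `(s, t)`, `0 < s` -/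

/-- **The local energy inequality of the heat flow, integrated in time.** Let `g ∈ Lᵖ`
(`1 ≤ p`), `u = e^{·Δ}g`, `R > 0`, `x₀ ∈ E`, `φ = χ_R(· − x₀)` the translated cut-off, and
suppose `‖Dχ_R‖ ≤ M` and `∫_{B_{3R}(x₀)} |u(τ)|² ≤ Eb` for all `τ > 0`. Then for `0 < s ≤ t`,
`∫ₛᵗ ∫ φ² |∇u|² dx dτ ≤ Eb + 4 n M² Eb (t − s)`: the heat equation on time lines
(`norm_sq_heatExtension_sub_eq_integral`), Fubini on `(s,t) × E`
(`integrable_prod_of_continuousOn`), and the slice inequality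
`integral_sq_mul_inner_laplacian_le`. Lemarié-Rieusset 2016, proof of Thm 14.1, Step 1
((14.5)); Evans, *PDE*, §7.1.2. [cite: LemarieRieusset2016, Theorem 14.1 (proof, Step 1)] -/
theorem integral_Ioo_integral_cutoff_sq_frobeniusNormSq_le (hg : MemLp g p volume) (hp : 1 ≤ p)
    {R : ℝ} (hR : 0 < R) (x₀ : E) {M : ℝ} (hM : ∀ x, ‖fderiv ℝ (cutoff (E := E) R) x‖ ≤ M)
    {Eb : ℝ} (hE : ∀ τ : ℝ, 0 < τ → ∫ x in ball x₀ (3 * R), ‖heatExtension g τ x‖ ^ 2 ≤ Eb)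
    {s t : ℝ} (hs : 0 < s) (hst : s ≤ t) :
    ∫ τ in Ioo s t, ∫ x, cutoff R (x - x₀) * cutoff R (x - x₀) *
        frobeniusNormSq (fderiv ℝ (heatExtension g τ) x) ≤
      Eb + 4 * (Module.finrank ℝ E : ℝ) * M ^ 2 * Eb * (t - s) := by
  haveI : CompleteSpace F' := FiniteDimensional.complete ℝ F'
  set n : ℝ := (Module.finrank ℝ E : ℝ) with hn
  set φ : E → ℝ := fun x => cutoff R (x - x₀) with hφdef
  set u : ℝ → E → F' := fun τ => heatExtension g τ with hudef
  -- the cut-off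
  have hφ1 : ContDiff ℝ 1 φ := contDiff_cutoff_sub R x₀
  have hφc : HasCompactSupport φ := hasCompactSupport_cutoff_sub hR x₀
  have hφM : ∀ x, ‖fderiv ℝ φ x‖ ≤ M := fun x => by
    rw [hφdef, norm_fderiv_cutoff_sub]; exact hM _
  have hφS : ∀ x ∉ ball x₀ (3 * R), fderiv ℝ φ x = 0 := fun x hx => fderiv_cutoff_sub_eq_zero hR hx
  have hφK : ∀ x ∉ closedBall x₀ (2 * R), φ x = 0 := fun x hx =>
    cutoff_sub_eq_zero_of_notMem_ball hR fun h => hx (ball_subset_closedBall h)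
  have hφ01 : ∀ x, 0 ≤ φ x ∧ φ x ≤ 1 := fun x => ⟨cutoff_nonneg _ _, cutoff_le_one _ _⟩
  have hφcont : Continuous φ := hφ1.continuous
  -- regularity of the heat flow
  have hu2 : ∀ τ, 0 < τ → ContDiff ℝ 2 (u τ) := fun τ hτ =>
    contDiff_infty.1 (contDiff_heatExtension_holds hg hp hτ) 2
  have huc : ∀ τ, 0 < τ → Continuous (u τ) := fun τ hτ => (hu2 τ hτ).continuous
  have hsub : Icc s t ×ˢ (univ : Set E) ⊆ Ioi 0 ×ˢ univ :=
    prod_mono (fun τ hτ => lt_of_lt_of_le hs hτ.1) Subset.rfl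
  have cu : ContinuousOn (fun z : ℝ × E => u z.1 z.2) (Icc s t ×ˢ univ) :=
    (continuousOn_uncurry_heatExtension_of_memLp hg hp).mono hsub
  have cL : ContinuousOn (fun z : ℝ × E => (Δ (u z.1)) z.2) (Icc s t ×ˢ univ) :=
    (continuousOn_uncurry_laplacian_heatExtension_of_memLp hg hp).mono hsub
  have cDu : ContinuousOn (fun z : ℝ × E => fderiv ℝ (u z.1) z.2) (Icc s t ×ˢ univ) := by
    refine (continuousOn_clm_apply.2 fun v => ?_).mono hsub
    exact continuousOn_uncurry_fderiv_heatExtension_of_memLp hg hp v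
  have cφ : ContinuousOn (fun z : ℝ × E => φ z.2 * φ z.2) (Icc s t ×ˢ univ) :=
    ((hφcont.mul hφcont).comp continuous_snd).continuousOn
  -- the two space–time integrands and their integrability on `(s, t) × E`
  set D : ℝ × E → ℝ := fun z => φ z.2 * φ z.2 * (2 * ⟪u z.1 z.2, (Δ (u z.1)) z.2⟫) with hD
  set B : ℝ × E → ℝ := fun z => φ z.2 * φ z.2 * frobeniusNormSq (fderiv ℝ (u z.1) z.2) with hB
  have hDint : Integrable D (((volume : Measure ℝ).restrict (Ioo s t)).prod (volume : Measure E)) :=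
    integrable_prod_of_continuousOn (isCompact_closedBall x₀ (2 * R))
      (cφ.mul (continuousOn_const.mul (cu.inner cL))) fun τ _ x hx => by simp [hD, hφK x hx]
  have hBint : Integrable B (((volume : Measure ℝ).restrict (Ioo s t)).prod (volume : Measure E)) :=
    integrable_prod_of_continuousOn (isCompact_closedBall x₀ (2 * R))
      (cφ.mul (LerayHopfProofs.continuous_frobeniusNormSq.comp_continuousOn cDu))
      fun τ _ x hx => by simp [hB, hφK x hx]
  have jD := hDint.integral_prod_left
  have jB := hBint.integral_prod_left
  simp only [hD, hB] at jD jB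
  -- the slice inequality for `τ ∈ (s, t)`
  have hslice : ∀ τ ∈ Ioo s t, ∫ x, φ x * φ x * (2 * ⟪u τ x, (Δ (u τ)) x⟫) ≤
      -(∫ x, φ x * φ x * frobeniusNormSq (fderiv ℝ (u τ) x)) + 4 * n * M ^ 2 * Eb := by
    intro τ hτ
    have hτ0 : 0 < τ := hs.trans hτ.1
    exact integral_sq_mul_inner_laplacian_le (hu2 τ hτ0) hφ1 hφc hφM measurableSet_ball hφS
      (integrableOn_ball_norm_heatExtension_sq hg hp hτ0 x₀ (3 * R)) (hE τ hτ0)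
  -- the heat equation on time lines, integrated against `φ²`
  have hslice_int : ∀ {r : ℝ}, 0 < r →
      Integrable (fun x => φ x * φ x * ‖u r x‖ ^ 2) (volume : Measure E) := fun hr =>
    ((hφcont.mul hφcont).mul ((huc _ hr).norm.pow 2)).integrable_of_hasCompactSupport
      (hφc.mul_right.mul_right)
  have hline : ∀ x, ∫ τ in Ioo s t, D (τ, x) =
      φ x * φ x * ‖u t x‖ ^ 2 - φ x * φ x * ‖u s x‖ ^ 2 := by
    intro x
    have h1 := norm_sq_heatExtension_sub_eq_integral hg hp hs hst x
    rw [intervalIntegral.integral_of_le hst, integral_Ioc_eq_integral_Ioo] at h1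
    have h1' : ‖u t x‖ ^ 2 - ‖u s x‖ ^ 2 =
        ∫ τ in Ioo s t, 2 * ⟪u τ x, (Δ (u τ)) x⟫ := h1
    simp only [hD]
    rw [integral_const_mul, ← mul_sub, ← h1']
  have hFTC : ∫ τ in Ioo s t, ∫ x, D (τ, x) =
      (∫ x, φ x * φ x * ‖u t x‖ ^ 2) - ∫ x, φ x * φ x * ‖u s x‖ ^ 2 := by
    rw [integral_integral_swap hDint, integral_congr_ae (Eventually.of_forall hline),
      integral_sub (hslice_int (hs.trans_le hst)) (hslice_int hs)]
  -- integrate the slice inequality over `(s, t)`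
  have hconst : IntegrableOn (fun _ : ℝ => 4 * n * M ^ 2 * Eb) (Ioo s t) volume :=
    integrableOn_const (by simp [Real.volume_Ioo])
  have jBneg : Integrable (fun τ => -∫ x, φ x * φ x * frobeniusNormSq (fderiv ℝ (u τ) x))
      ((volume : Measure ℝ).restrict (Ioo s t)) := jB.neg
  have hmono : ∫ τ in Ioo s t, ∫ x, D (τ, x) ≤
      ∫ τ in Ioo s t, (-(∫ x, φ x * φ x * frobeniusNormSq (fderiv ℝ (u τ) x)) +
        4 * n * M ^ 2 * Eb) :=
    setIntegral_mono_on jD (jBneg.add hconst) measurableSet_Ioo fun τ hτ => hslice τ hτ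
  rw [integral_add jBneg hconst, integral_neg, setIntegral_const, hFTC] at hmono
  have hvol : (volume : Measure ℝ).real (Ioo s t) = t - s := by
    rw [measureReal_def, Real.volume_Ioo, ENNReal.toReal_ofReal (sub_nonneg.2 hst)]
  rw [hvol, smul_eq_mul] at hmono
  -- the boundary terms: `0 ≤ ∫ φ²|u(t)|²` and `∫ φ²|u(s)|² ≤ Eb`
  have ht0 : 0 ≤ ∫ x, φ x * φ x * ‖u t x‖ ^ 2 :=
    integral_nonneg fun x => mul_nonneg (mul_self_nonneg _) (sq_nonneg _)
  have hs1 : ∫ x, φ x * φ x * ‖u s x‖ ^ 2 ≤ Eb := by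
    refine le_trans ?_ (hE s hs)
    rw [← integral_indicator measurableSet_ball]
    refine integral_mono (hslice_int hs)
      ((integrableOn_ball_norm_heatExtension_sq hg hp hs x₀ (3 * R)).integrable_indicator
        measurableSet_ball) fun x => ?_
    by_cases hx : x ∈ ball x₀ (3 * R)
    · rw [indicator_of_mem hx]
      have := hφ01 x
      calc φ x * φ x * ‖u s x‖ ^ 2 ≤ 1 * 1 * ‖u s x‖ ^ 2 := by
            refine mul_le_mul_of_nonneg_right ?_ (sq_nonneg _)
            exact mul_le_mul this.2 this.2 this.1 zero_le_one
        _ = ‖heatExtension g s x‖ ^ 2 := by rw [one_mul, one_mul]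
    · rw [indicator_of_notMem hx]
      have hx' : x ∉ closedBall x₀ (2 * R) := fun h => hx (by
        rw [mem_closedBall] at h; rw [mem_ball]; linarith)
      simp [hφK x hx']
  show ∫ τ in Ioo s t, ∫ x, φ x * φ x * frobeniusNormSq (fderiv ℝ (u τ) x) ≤ _
  linarith

/-! #### The uniformly local enstrophy bound -/

/-- **Local enstrophy on `(s, R²) × B_R(x₀)`, `0 < s`**, in `lintegral` form: with the data of
`integral_Ioo_integral_cutoff_sq_frobeniusNormSq_le` (and `0 ≤ Eb`),
`∫∫_{(s,t) × B_R(x₀)} |∇e^{τΔ}g|² ≤ Eb + 4 n M² Eb t`. [cite: LemarieRieusset2016, Theorem 14.1 (proof, Step 1)] -/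
theorem setLIntegral_box_frobeniusNormSq_fderiv_heatExtension_le (hg : MemLp g p volume)
    (hp : 1 ≤ p) {R : ℝ} (hR : 0 < R) (x₀ : E) {M : ℝ}
    (hM : ∀ x, ‖fderiv ℝ (cutoff (E := E) R) x‖ ≤ M) {Eb : ℝ} (hEb : 0 ≤ Eb)
    (hE : ∀ τ : ℝ, 0 < τ → ∫ x in ball x₀ (3 * R), ‖heatExtension g τ x‖ ^ 2 ≤ Eb)
    {s t : ℝ} (hs : 0 < s) (hst : s ≤ t) :
    ∫⁻ z in Ioo s t ×ˢ ball x₀ R,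
        ENNReal.ofReal (frobeniusNormSq (fderiv ℝ (heatExtension g z.1) z.2)) ≤
      ENNReal.ofReal (Eb + 4 * (Module.finrank ℝ E : ℝ) * M ^ 2 * Eb * t) := by
  haveI : CompleteSpace F' := FiniteDimensional.complete ℝ F'
  set n : ℝ := (Module.finrank ℝ E : ℝ) with hn
  set φ : E → ℝ := fun x => cutoff R (x - x₀) with hφdef
  have hφcont : Continuous φ := (contDiff_cutoff_sub R x₀ (n := 1)).continuous
  have hφK : ∀ x ∉ closedBall x₀ (2 * R), φ x = 0 := fun x hx =>
    cutoff_sub_eq_zero_of_notMem_ball hR fun h => hx (ball_subset_closedBall h)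
  -- the weighted enstrophy density and its integrability on `(s, t) × E`
  set B : ℝ × E → ℝ := fun z => φ z.2 * φ z.2 *
    frobeniusNormSq (fderiv ℝ (heatExtension g z.1) z.2) with hB
  have hsub : Icc s t ×ˢ (univ : Set E) ⊆ Ioi 0 ×ˢ univ :=
    prod_mono (fun τ hτ => lt_of_lt_of_le hs hτ.1) Subset.rfl
  have cDu : ContinuousOn (fun z : ℝ × E => fderiv ℝ (heatExtension g z.1) z.2)
      (Icc s t ×ˢ univ) := by
    refine (continuousOn_clm_apply.2 fun v => ?_).mono hsub
    exact continuousOn_uncurry_fderiv_heatExtension_of_memLp hg hp v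
  have cφ : ContinuousOn (fun z : ℝ × E => φ z.2 * φ z.2) (Icc s t ×ˢ univ) :=
    ((hφcont.mul hφcont).comp continuous_snd).continuousOn
  have hBint : Integrable B (((volume : Measure ℝ).restrict (Ioo s t)).prod (volume : Measure E)) :=
    integrable_prod_of_continuousOn (isCompact_closedBall x₀ (2 * R))
      (cφ.mul (LerayHopfProofs.continuous_frobeniusNormSq.comp_continuousOn cDu))
      fun τ _ x hx => by simp [hB, hφK x hx]
  have hBnn : ∀ z, 0 ≤ B z := fun z =>
    mul_nonneg (mul_self_nonneg _) (frobeniusNormSq_nonneg _)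
  -- the time-integrated local energy inequality
  have hmain := integral_Ioo_integral_cutoff_sq_frobeniusNormSq_le hg hp hR x₀ hM hE hs hst
  have hM0 : 0 ≤ M := (norm_nonneg _).trans (hM 0)
  calc ∫⁻ z in Ioo s t ×ˢ ball x₀ R,
        ENNReal.ofReal (frobeniusNormSq (fderiv ℝ (heatExtension g z.1) z.2))
      = ∫⁻ z in Ioo s t ×ˢ ball x₀ R, ENNReal.ofReal (B z) := by
        refine setLIntegral_congr_fun (measurableSet_Ioo.prod measurableSet_ball) fun z hz => ?_
        simp only [hB, hφdef, cutoff_sub_eq_one_of_mem_ball hR hz.2, one_mul]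
    _ ≤ ∫⁻ z in Ioo s t ×ˢ (univ : Set E), ENNReal.ofReal (B z) :=
        lintegral_mono_set (prod_mono Subset.rfl (subset_univ _))
    _ = ∫⁻ z, ENNReal.ofReal (B z) ∂(((volume : Measure ℝ).restrict (Ioo s t)).prod
          (volume : Measure E)) := by
        rw [Measure.restrict_prod_eq_prod_univ, Measure.volume_eq_prod]
    _ = ENNReal.ofReal (∫ z, B z ∂(((volume : Measure ℝ).restrict (Ioo s t)).prod
          (volume : Measure E))) :=
        (ofReal_integral_eq_lintegral_ofReal hBint (Eventually.of_forall hBnn)).symm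
    _ = ENNReal.ofReal (∫ τ in Ioo s t, ∫ x, B (τ, x)) := by rw [integral_prod _ hBint]
    _ ≤ ENNReal.ofReal (Eb + 4 * n * M ^ 2 * Eb * (t - s)) := ENNReal.ofReal_le_ofReal hmain
    _ ≤ ENNReal.ofReal (Eb + 4 * n * M ^ 2 * Eb * t) := by
        refine ENNReal.ofReal_le_ofReal ?_
        have : 0 ≤ 4 * n * M ^ 2 * Eb := by positivity
        nlinarith

/-- **Uniformly local enstrophy of the heat flow of `Lᵖ` data.** For `g ∈ Lᵖ(E; F')`,
`2 ≤ p < ∞`, and every `R > 0` there is `C` with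
`∫₀^{R²} ∫_{B_R(x₀)} |∇ e^{tΔ}g|² dx dt ≤ C` for all `x₀ ∈ E` — the hypothesis `hgrad` of
`isCaloricLocalLerayField_heatExtension_of_memLp`, i.e. [BT1] §4: "`v₀ ∈ L²_uloc` implies
`e^{tΔ}v₀` has uniformly locally finite … enstrophy" (Lemarié-Rieusset 2016, Thm 14.1, proof,
Step 1, (14.5): `sup_x ‖∇ ⊗ (W_{νt} ⋆ u₀)‖_{L²((0,T)×B(x,1))} ≤ C_ν ‖u₀‖_{L²_uloc}`). Proof:
`setLIntegral_box_frobeniusNormSq_fderiv_heatExtension_le` on `(R²/(k+1), R²)` with the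
cut-off gradient bound `C/R` (`exists_norm_fderiv_cutoff_le`) and the energy majorant
`|B_{3R}|^{1−2/p}‖g‖_p²` (`integral_ball_norm_heatExtension_sq_le`), then `k → ∞` by monotone
convergence of the sets. [cite: BradshawTsai2017AHP, §4 (proof of Thm 1.2)] [cite: LemarieRieusset2016, Theorem 14.1 (proof, Step 1)] -/
theorem exists_setLIntegral_box_frobeniusNormSq_fderiv_heatExtension_le (hp : 2 ≤ p)
    (hp' : p ≠ ∞) (hg : MemLp g p volume) {R : ℝ} (hR : 0 < R) :
    ∃ C : ℝ≥0, ∀ x₀ : E, ∫⁻ z in Ioo 0 (R ^ 2) ×ˢ ball x₀ R,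
      ENNReal.ofReal (frobeniusNormSq (fderiv ℝ (heatExtension g z.1) z.2)) ≤ C := by
  have hp1 : 1 ≤ p := one_le_two.trans hp
  obtain ⟨C₀, hC₀, hC⟩ := exists_norm_fderiv_cutoff_le (E := E)
  set M : ℝ := C₀ / R with hMdef
  have hM : ∀ x, ‖fderiv ℝ (cutoff (E := E) R) x‖ ≤ M := hC R hR
  set Eb : ℝ := (volume (ball (0 : E) (3 * R)) ^ (1 - 2 / p.toReal) *
    eLpNorm g p volume ^ 2).toReal with hEbdef
  have hEb : 0 ≤ Eb := ENNReal.toReal_nonneg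
  have hE : ∀ x₀ : E, ∀ τ : ℝ, 0 < τ →
      ∫ x in ball x₀ (3 * R), ‖heatExtension g τ x‖ ^ 2 ≤ Eb := fun x₀ τ hτ =>
    integral_ball_norm_heatExtension_sq_le hp hp' hg hτ x₀ (3 * R)
  set n : ℝ := (Module.finrank ℝ E : ℝ) with hn
  refine ⟨(Eb + 4 * n * M ^ 2 * Eb * R ^ 2).toNNReal, fun x₀ => ?_⟩
  show _ ≤ ENNReal.ofReal (Eb + 4 * n * M ^ 2 * Eb * R ^ 2)
  -- exhaust `(0, R²)` by the intervals `(R²/(k+1), R²)`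
  set sk : ℕ → ℝ := fun k => R ^ 2 / ((k : ℝ) + 1) with hsk
  have hsk_pos : ∀ k, 0 < sk k := fun k => by positivity
  have hsk_le : ∀ k, sk k ≤ R ^ 2 := fun k =>
    div_le_self (by positivity) (by linarith [(k.cast_nonneg : (0 : ℝ) ≤ k)])
  have hcover : Ioo 0 (R ^ 2) ×ˢ ball x₀ R ⊆ ⋃ k, Ioo (sk k) (R ^ 2) ×ˢ ball x₀ R := by
    rintro ⟨τ, x⟩ ⟨⟨hτ0, hτ1⟩, hx⟩
    obtain ⟨k, hk⟩ := exists_nat_gt (R ^ 2 / τ)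
    refine mem_iUnion.2 ⟨k, ⟨?_, hτ1⟩, hx⟩
    show R ^ 2 / ((k : ℝ) + 1) < τ
    rw [div_lt_iff₀ (by positivity)]
    rw [div_lt_iff₀ hτ0] at hk
    nlinarith
  have hdir : Directed (· ⊆ ·) fun k => Ioo (sk k) (R ^ 2) ×ˢ ball x₀ R := by
    refine Monotone.directed_le fun j k hjk => prod_mono (Ioo_subset_Ioo ?_ le_rfl) Subset.rfl
    exact div_le_div_of_nonneg_left (by positivity) (by positivity)
      (by exact_mod_cast Nat.succ_le_succ hjk)
  calc ∫⁻ z in Ioo 0 (R ^ 2) ×ˢ ball x₀ R,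
        ENNReal.ofReal (frobeniusNormSq (fderiv ℝ (heatExtension g z.1) z.2))
      ≤ ∫⁻ z in ⋃ k, Ioo (sk k) (R ^ 2) ×ˢ ball x₀ R,
          ENNReal.ofReal (frobeniusNormSq (fderiv ℝ (heatExtension g z.1) z.2)) :=
        lintegral_mono_set hcover
    _ = ⨆ k, ∫⁻ z in Ioo (sk k) (R ^ 2) ×ˢ ball x₀ R,
          ENNReal.ofReal (frobeniusNormSq (fderiv ℝ (heatExtension g z.1) z.2)) :=
        setLIntegral_iUnion_of_directed _ hdir
    _ ≤ ENNReal.ofReal (Eb + 4 * n * M ^ 2 * Eb * R ^ 2) :=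
        iSup_le fun k => setLIntegral_box_frobeniusNormSq_fderiv_heatExtension_le hg hp1 hR x₀
          hM hEb (hE x₀) (hsk_pos k) (hsk_le k)

end HeatFlow

end Literature.Analysis.FluidPDE

end
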